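/-
Copyright (c) 2026 the pub-hodgecm-mathlib formalisation cell (harness21).  Prover seat hodgecm-mathlib-F0P3a-p01 (g36), FLOOR 0, SUPPORTS-ONLY on h413; dealer LH4-plan (g13)
WORD #74 (1): owner of (T-box | lev) (b)+(c).  FILE 2 «LEV TILING».  2026-09-04.
-/
import Summits.HodgeConjecture.HodgeConjecture.Theorems.F0P3cDyRamKappaCountBoxSumTiling   -- ★ p14 FILE 3: `leaf_T`, `leaf_Z`, `leaf_TT`
import Summits.HodgeConjecture.HodgeConjecture.Theorems.F0P3cDyRamLevBoxSumArith         -- FILE 2a (this seat): the pure-ℕ letters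
import Summits.HodgeConjecture.HodgeConjecture.Theorems.F0P3cDyRamLevBoxSumTiling   -- FILE 2b: `min3_linear`, `max_linear`
import HarnessLib

/-!
# Crux `H413`, LH4 «(D-RAM) FOUR-FRAME» road, STAGE 1b — brick (T-box | lev) FILE 2e «LEV TILING, equilateral» — ED. 2 (proof-only: lint debt repaid, linter options removed, tolerant `simp` passes pruned; statements unchanged)

Cell `hodgecm-mathlib` (D-0151), crux item H413 = `stmt-HodgeConjecture-24833`, route of record `HCCMUnconditional`.  THEOREMS ONLY (pure `ℕ`∕`ℚ` bookkeeping; no lattices,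
no `def`, no instance, no notation, no `sorry`, default heartbeats); lane `--supports stmt-HodgeConjecture-24833 --as helper` (count-neutral).  Twin of ★ `kappa_arith`
(LH4-p14 (g3), `ℓ₁ = ℓ₂ = 0`) and ★ `kappa_arith_trunc` (LH4-p10 (g6), the row `(0, mstarOfRecord d)`), for the tables of ★ p860066∕p860094 `LevLabelledBoxSum(Wide) ℓ₁ ℓ₂`.

THE MATHEMATICS (memo `F0/P3a/F0P3a-p01/g36/tbox/TBOX-LEV-SPEC.v1.F0P3ap01g36.md` 7f362386 §4; closed forms certified by `tbox/evalcheck.py`, 50 148 ∕ 50 148).  After FILE 1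
(`kappa_plane_sum_lev`, `kappa_diag_sum_lev`) and ★ `foot_mul_eval` ∕ ★ `window_mul_eval'`, `(x − 1)·Σ_{box}` of the two-token κ-table is a sum of evaluated blocks:
per apex plane the FOOT block `[⌊N∕2⌋ + d ≤ ⌊(n−ℓ₁)∕2⌋]·ω·(x^{⌊(n−ℓ₁)∕2⌋+⌊N∕2⌋+1} − x^{2⌊N∕2⌋+d})`, `N = min(min(n′,n″), n_r − ℓ₁, 2n_r − ℓ₂)`, and the LOCUS window
`εG·[max(1,L) ≤ C]·(x^{A+C+1} − x^{A+max(1,L)})`, `A = 2⌊(n′−ℓ₁)∕2⌋ + s∕2`, `L = d − s∕2 ∣ d`, `C = min(n′−ℓ₁−M, ⌊(2n′−ℓ₂)∕2⌋−M, ⌊(2n′−d+1−ℓ₁)∕2⌋−M)`,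
`M = ⌊(n′−ℓ₁)∕2⌋`; plus the H window on an equilateral key.  THE IDENTITY: their total is `SIGN·(x^{k−X} − x^{k−max(X, B+y)})`, `2k + d = Σn + 2`,
`2B = (n_i + 2(d%2) + 2 − 3d)⁺`, `y = 2⌈(ℓ₁ − d%2)∕2⌉`, `X = max(ℓ₁, (⌊(ℓ₂+1)∕2⌋ − ⌊d∕2⌋)⁺ + y∕2)`: the `D₂` level truncates the TOP of ★ `kappa_arith`'s tiling
`[k−B, k−1]`, the `D₁` level truncates the top at `k − ℓ₁` and, per foot-parity step, OPENS TWO LAYERS BELOW the unit's bottom.  Rows of record: lo `(cs, 0)`,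
hi `(cs+1, 2)`, clean-lo `(sT, 0)`, clean-hi `(sT+1, 2)`.  MECHANISM of the proof: parities made explicit (`d = 2e+δ`, `n = 2a+δ`, …), slots by `fin_cases`, the
conductor side condition `εG p p = ω` when the apex excess is `≥ 2d`, every leaf an exponent identity closed by `omega` (which digests `min`, `max`, `∕2`).
* `kappa_arith_lev_apex0`, `kappa_arith_lev_apex1`, `kappa_arith_lev_apex2` (strictly isoceles keys), `kappa_arith_lev_equi` (equilateral), and the dispatch
  **`kappa_arith_lev`** — HEAD, hypotheses = ★ p860094 `LevLabelledBoxSumWide`'s arithmetic ones.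

HONEST LABEL: arithmetic helper toward `levLabelledBoxSumWide_holds` (FILE 3); pays no tier-0 row; the four (L-lev) law stubs and their `hTrunk` binders stay OPEN; HC_CM is
proved only modulo the 7 printed citations (2 remaining named inputs: hLiu418 = `stmt-HodgeConjecture-24832`, h413 = `stmt-HodgeConjecture-24833`) until rung 0 closes.

## References
* [Kottwitz1986BaseChangeUnits] R. E. Kottwitz, *Base change for unit elements of Hecke algebras*, Compositio Math. 60 (1986), §1 pp. 240–241.
* [Rogawski1990] J. D. Rogawski, *Automorphic Representations of Unitary Groups in Three Variables*, Ann. of Math. Stud. 123 (1990), §4.9 Prop. 4.9.1 (a) p. 55; §4.10 p. 58.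
-/

set_option autoImplicit false

namespace Summit.HodgeConjecture.HodgeConjecture.Cruxes.H413.F0P3cDyRamLevBoxSumTilingEqui

open Finset
open Summit.HodgeConjecture.HodgeConjecture.Cruxes.H413.F0P3cDyRamKappaCountBoxSumTiling (leaf_T leaf_Z leaf_TT)
open Summit.HodgeConjecture.HodgeConjecture.Cruxes.H413.F0P3cDyRamLevBoxSumArith
open Summit.HodgeConjecture.HodgeConjecture.Cruxes.H413.F0P3cDyRamLevBoxSumTiling (min3_linear max_linear)


/-- The lev tiling, equilateral key, slot `0`: only the (shifted) H window is alive. [folklore] -/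
theorem kappa_arith_lev_equi_slot0 (x ω εH : ℚ) (εG : Fin 3 → Fin 3 → ℚ) {d n₁ k ℓ₁ ℓ₂ : ℕ} (hd : 2 ≤ d) (hl : n₁ % 2 = d % 2)
    (hk : 2 * k + d = n₁ + n₁ + n₁ + 2) (hfg : 2 * d ≤ n₁ + 1) (hℓ₁ : ℓ₁ ≤ 2) (hℓ₂ : ℓ₂ ≤ n₁ + ℓ₁) (hcorner : d % 2 = 0 → ℓ₁ = 1 → d + 1 ≤ ℓ₂)
    (i : Fin 3) (hi : i = 0) :
    (if n₁ = n₁ ∧ n₁ = n₁ then εH * (if max 1 d ≤ min (n₁ - ℓ₁ - (n₁ - ℓ₁) / 2) (min ((2 * n₁ - ℓ₂) / 2 - (n₁ - ℓ₁) / 2) ((2 * n₁ - d + 1 - ℓ₁) / 2 - (n₁ - ℓ₁) / 2)) then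
          x ^ (2 * ((n₁ - ℓ₁) / 2) + min (n₁ - ℓ₁ - (n₁ - ℓ₁) / 2) (min ((2 * n₁ - ℓ₂) / 2 - (n₁ - ℓ₁) / 2) ((2 * n₁ - d + 1 - ℓ₁) / 2 - (n₁ - ℓ₁) / 2)) + 1) - x ^ (2 * ((n₁ - ℓ₁) / 2) + max 1 d) else 0) else 0) +
        ((if i = 0 then (if min (min n₁ n₁) (min (n₁ - ℓ₁) (2 * n₁ - ℓ₂)) / 2 + d ≤ (n₁ - ℓ₁) / 2 then
            ω * (x ^ ((n₁ - ℓ₁) / 2 + min (min n₁ n₁) (min (n₁ - ℓ₁) (2 * n₁ - ℓ₂)) / 2 + 1) - x ^ (2 * (min (min n₁ n₁) (min (n₁ - ℓ₁) (2 * n₁ - ℓ₂)) / 2) + d)) else 0) else 0) +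
          (if n₁ = n₁ ∧ n₁ < n₁ ∧ (n₁ - n₁) % 2 = 0 then εG 0 i *
            (if max 1 (if i = 0 then d - (n₁ - n₁) / 2 else d) ≤ min (n₁ - ℓ₁ - (n₁ - ℓ₁) / 2) (min ((2 * n₁ - ℓ₂) / 2 - (n₁ - ℓ₁) / 2) ((2 * n₁ - d + 1 - ℓ₁) / 2 - (n₁ - ℓ₁) / 2)) then
              x ^ (2 * ((n₁ - ℓ₁) / 2) + (n₁ - n₁) / 2 + min (n₁ - ℓ₁ - (n₁ - ℓ₁) / 2) (min ((2 * n₁ - ℓ₂) / 2 - (n₁ - ℓ₁) / 2) ((2 * n₁ - d + 1 - ℓ₁) / 2 - (n₁ - ℓ₁) / 2)) + 1) -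
                x ^ (2 * ((n₁ - ℓ₁) / 2) + (n₁ - n₁) / 2 + max 1 (if i = 0 then d - (n₁ - n₁) / 2 else d)) else 0) else 0)) +
        ((if i = 1 then (if min (min n₁ n₁) (min (n₁ - ℓ₁) (2 * n₁ - ℓ₂)) / 2 + d ≤ (n₁ - ℓ₁) / 2 then
            ω * (x ^ ((n₁ - ℓ₁) / 2 + min (min n₁ n₁) (min (n₁ - ℓ₁) (2 * n₁ - ℓ₂)) / 2 + 1) - x ^ (2 * (min (min n₁ n₁) (min (n₁ - ℓ₁) (2 * n₁ - ℓ₂)) / 2) + d)) else 0) else 0) +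
          (if n₁ = n₁ ∧ n₁ < n₁ ∧ (n₁ - n₁) % 2 = 0 then εG 1 i *
            (if max 1 (if i = 1 then d - (n₁ - n₁) / 2 else d) ≤ min (n₁ - ℓ₁ - (n₁ - ℓ₁) / 2) (min ((2 * n₁ - ℓ₂) / 2 - (n₁ - ℓ₁) / 2) ((2 * n₁ - d + 1 - ℓ₁) / 2 - (n₁ - ℓ₁) / 2)) then
              x ^ (2 * ((n₁ - ℓ₁) / 2) + (n₁ - n₁) / 2 + min (n₁ - ℓ₁ - (n₁ - ℓ₁) / 2) (min ((2 * n₁ - ℓ₂) / 2 - (n₁ - ℓ₁) / 2) ((2 * n₁ - d + 1 - ℓ₁) / 2 - (n₁ - ℓ₁) / 2)) + 1) -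
                x ^ (2 * ((n₁ - ℓ₁) / 2) + (n₁ - n₁) / 2 + max 1 (if i = 1 then d - (n₁ - n₁) / 2 else d)) else 0) else 0)) +
        ((if i = 2 then (if min (min n₁ n₁) (min (n₁ - ℓ₁) (2 * n₁ - ℓ₂)) / 2 + d ≤ (n₁ - ℓ₁) / 2 then
            ω * (x ^ ((n₁ - ℓ₁) / 2 + min (min n₁ n₁) (min (n₁ - ℓ₁) (2 * n₁ - ℓ₂)) / 2 + 1) - x ^ (2 * (min (min n₁ n₁) (min (n₁ - ℓ₁) (2 * n₁ - ℓ₂)) / 2) + d)) else 0) else 0) +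
          (if n₁ = n₁ ∧ n₁ < n₁ ∧ (n₁ - n₁) % 2 = 0 then εG 2 i *
            (if max 1 (if i = 2 then d - (n₁ - n₁) / 2 else d) ≤ min (n₁ - ℓ₁ - (n₁ - ℓ₁) / 2) (min ((2 * n₁ - ℓ₂) / 2 - (n₁ - ℓ₁) / 2) ((2 * n₁ - d + 1 - ℓ₁) / 2 - (n₁ - ℓ₁) / 2)) then
              x ^ (2 * ((n₁ - ℓ₁) / 2) + (n₁ - n₁) / 2 + min (n₁ - ℓ₁ - (n₁ - ℓ₁) / 2) (min ((2 * n₁ - ℓ₂) / 2 - (n₁ - ℓ₁) / 2) ((2 * n₁ - d + 1 - ℓ₁) / 2 - (n₁ - ℓ₁) / 2)) + 1) -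
                x ^ (2 * ((n₁ - ℓ₁) / 2) + (n₁ - n₁) / 2 + max 1 (if i = 2 then d - (n₁ - n₁) / 2 else d)) else 0) else 0))
      = (if n₁ = n₁ ∧ n₁ = n₁ then εH else if n₁ = n₁ then εG 0 i else if n₁ = n₁ then εG 1 i else εG 2 i) *
        (x ^ (k - max ℓ₁ ((ℓ₂ + 1) / 2 - d / 2 + (ℓ₁ + 1 - d % 2) / 2)) -
          x ^ (k - max (max ℓ₁ ((ℓ₂ + 1) / 2 - d / 2 + (ℓ₁ + 1 - d % 2) / 2))
            ((((![n₁, n₁, n₁] : Fin 3 → ℕ) i + 2 * (d % 2) + 2 - 3 * d) / 2) + 2 * ((ℓ₁ + 1 - d % 2) / 2)))) := by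
  subst hi
  obtain ⟨δ, e, hδ, rfl⟩ : ∃ δ e, δ ≤ 1 ∧ d = 2 * e + δ := ⟨d % 2, d / 2, by omega, by omega⟩
  obtain ⟨a, rfl⟩ : ∃ a, n₁ = 2 * a + δ := ⟨n₁ / 2, by omega⟩
  obtain ⟨t₁, ht₁⟩ : ∃ t₁, 2 * a + δ = t₁ + ℓ₁ := ⟨2 * a + δ - ℓ₁, by omega⟩
  obtain ⟨t₂, ht₂⟩ : ∃ t₂, 2 * (2 * a + δ) = t₂ + ℓ₂ := ⟨2 * (2 * a + δ) - ℓ₂, by omega⟩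
  obtain ⟨t₃, ht₃⟩ : ∃ t₃, 2 * (2 * a + δ) + 1 = t₃ + (2 * e + δ) + ℓ₁ := ⟨2 * (2 * a + δ) + 1 - (2 * e + δ) - ℓ₁, by omega⟩
  obtain ⟨M, μ, hμ, hM⟩ : ∃ M μ, μ ≤ 1 ∧ t₁ = 2 * M + μ := ⟨t₁ / 2, t₁ % 2, by omega, by omega⟩
  obtain ⟨W, ν, hν, hW⟩ : ∃ W ν, ν ≤ 1 ∧ t₂ = 2 * W + ν := ⟨t₂ / 2, t₂ % 2, by omega, by omega⟩
  obtain ⟨V, κ, hκ, hV⟩ : ∃ V κ, κ ≤ 1 ∧ t₃ = 2 * V + κ := ⟨t₃ / 2, t₃ % 2, by omega, by omega⟩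
  obtain ⟨Gh, γ, hγ, hGh⟩ : ∃ Gh γ, γ ≤ 1 ∧ ℓ₂ + 1 = 2 * Gh + γ := ⟨(ℓ₂ + 1) / 2, (ℓ₂ + 1) % 2, by omega, by omega⟩
  obtain ⟨Yh, ψ, hψ, hYh⟩ : ∃ Yh ψ, ψ ≤ 1 ∧ ℓ₁ + 1 = 2 * Yh + ψ + δ := ⟨(ℓ₁ + 1 - δ) / 2, (ℓ₁ + 1 - δ) % 2, by omega, by omega⟩
  obtain ⟨r9, r10, r11⟩ : (2 * a + δ - ℓ₁ = t₁) ∧ (2 * (2 * a + δ) - ℓ₂ = t₂) ∧ (2 * (2 * a + δ) - (2 * e + δ) + 1 - ℓ₁ = t₃) :=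
    ⟨by clear * - hδ hd hℓ₁ hℓ₂ hfg ht₁ ht₂ ht₃; omega, by clear * - hδ hd hℓ₁ hℓ₂ hfg ht₁ ht₂ ht₃; omega, by clear * - hδ hd hℓ₁ hℓ₂ hfg ht₁ ht₂ ht₃; omega⟩
  obtain ⟨r13, r15, r17⟩ : (t₁ / 2 = M) ∧ (t₁ - M = M + μ) ∧ (t₂ / 2 = W) := ⟨by clear * - hμ hM; omega, by clear * - hμ hM; omega, by clear * - hν hW; omega⟩
  obtain ⟨r18, r19, r20⟩ : (t₃ / 2 = V) ∧ ((ℓ₂ + 1) / 2 = Gh) ∧ ((ℓ₁ + 1 - δ) / 2 = Yh) := ⟨by clear * - hκ hV; omega, by clear * - hγ hGh; omega, by clear * - hψ hYh hδ; omega⟩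
  obtain ⟨r1, r2, r7⟩ : ((2 * e + δ) % 2 = δ) ∧ ((2 * e + δ) / 2 = e) ∧ ((2 * a + δ + 2 * δ + 2 - 3 * (2 * e + δ)) / 2 = a + 1 - 3 * e) :=
    ⟨by clear * - hδ; omega, by clear * - hδ; omega, by clear * - hδ; omega⟩
  have rN : min (min (2 * a + δ) (2 * a + δ)) (min t₁ t₂) = t₁ := by clear * - hδ hd hℓ₁ hℓ₂ hfg ht₁ ht₂ ht₃; omega
  (try simp only [lt_self_iff_false]); (try simp only [Nat.sub_self, Nat.zero_mod]); (try simp only [false_and]); (try simp only [and_false]); (try simp only [and_self])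
  (try simp only [↓reduceIte]); (try simp only [Fin.isValue, Fin.reduceEq]); (try simp only [↓reduceIte]); (try simp only [zero_add]); (try simp only [add_zero])
  (try simp only [r1]); (try simp only [r2])
  (try simp only [Matrix.cons_val_zero]); (try simp only [r7]); (try simp only [r9]); (try simp only [r10]); (try simp only [r11])
  (try simp only [r19]); (try simp only [r20]); (try simp only [rN]); (try simp only [r13]); (try simp only [r15]); (try simp only [r17])
  (try simp only [r18])
  clear r1 r2 r7 r9 r10 r11 r13 r15 r17 r18 r19 r20 rN hl
  have hk' : k + e = 3 * a + 0 + δ + 1 := by clear * - hk; omega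
  clear hk
  obtain ⟨cW, rfl⟩ : ∃ cW, W = M + cW := ⟨W - M, by clear * - hδ hℓ₁ hℓ₂ ht₁ ht₂ hμ hM hν hW; omega⟩
  obtain ⟨cV, rfl⟩ : ∃ cV, V = M + cV := ⟨V - M, by clear * - hδ hd hℓ₁ hfg ht₁ ht₃ hμ hM hκ hV; omega⟩
  simp only [Nat.add_sub_cancel_left]
  obtain ⟨hM', hcW, hcV⟩ : (2 * M + μ + ℓ₁ = 2 * a + δ) ∧ (cW + Gh = M + μ + ℓ₁) ∧ (cV + e = a + μ) :=
    ⟨by clear * - hM ht₁; omega, by clear * - hM ht₁ hW ht₂ hGh hν hγ hℓ₂; omega, by clear * - hM ht₁ hV ht₃ hκ hμ hδ hfg; omega⟩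
  have hYh' : 2 * Yh + δ = ℓ₁ + μ := by clear * - hM ht₁ hYh hψ hμ hδ hℓ₁; omega
  clear ht₁ ht₂ ht₃ hM hW hV hYh hν hκ hψ
  generalize hC : min (M + μ) (min cW cV) = C
  have hC3 := min3_linear (M + μ) cW cV
  rw [hC] at hC3
  obtain ⟨x₂, hx₂, hx₂eq⟩ : ∃ x₂ : ℕ, ((e ≤ Gh ∧ Gh = e + x₂) ∨ (Gh < e ∧ x₂ = 0)) ∧ Gh - e = x₂ := by
    by_cases hGe : e ≤ Gh
    · exact ⟨Gh - e, Or.inl ⟨hGe, by omega⟩, rfl⟩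
    · exact ⟨0, Or.inr ⟨by omega, rfl⟩, by omega⟩
  rw [hx₂eq]
  generalize hX : max ℓ₁ (x₂ + Yh) = X
  have hX2 := max_linear ℓ₁ (x₂ + Yh)
  rw [hX] at hX2
  clear hC hX hx₂eq
  obtain ⟨Bq, hB, hBeq⟩ : ∃ Bq : ℕ, ((3 * e ≤ a + 1 ∧ Bq + 3 * e = a + 1) ∨ (a + 1 < 3 * e ∧ Bq = 0)) ∧ a + 1 - 3 * e = Bq := by
    by_cases h3 : 3 * e ≤ a + 1
    · exact ⟨a + 1 - 3 * e, Or.inl ⟨h3, by omega⟩, rfl⟩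
    · exact ⟨0, Or.inr ⟨by omega, rfl⟩, by omega⟩
  rw [hBeq]
  clear hBeq
  generalize hP : max X (Bq + 2 * Yh) = P
  have hP2 := max_linear X (Bq + 2 * Yh)
  rw [hP] at hP2
  clear hP
  have htube : ¬ (M + (2 * e + δ) ≤ M) := by clear * - hd; omega
  rw [if_neg htube, max_eq_right (show 1 ≤ 2 * e + δ by clear * - hd; omega)]
  (try simp only [add_zero])
  by_cases hwin : 2 * e + δ ≤ C
  · rw [if_pos hwin]
    exact leaf_T (by have h := lev_arith_top _ _ _ _ _ _ _ _ _ _ _ _ hδ hd hℓ₁ hμ hM' hcW hcV hYh' hk' _ hC3 _ hx₂ _ hX2; clear * - h; omega) (by have h := lev_arith_cross_bot _ _ _ _ _ _ _ _ _ _ _ _ hδ hd hℓ₁ hfg hμ hM' hcW hcV hYh' hk' _ hC3 _ hx₂ _ hX2 _ hB _ hP2 hwin; clear * - h; omega)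
  · rw [if_neg hwin, mul_zero]
    exact leaf_Z (by have h := lev_arith_cross_empty _ _ _ _ _ _ _ _ _ _ _ _ _ _ hδ hd hℓ₁ hcorner hfg hμ hM' hcW hcV hγ hGh hYh' hk' _ hC3 _ hx₂ _ hX2 _ hB _ hP2 hwin; clear * - h; omega)

/-- The lev tiling, equilateral key, slot `1`: only the (shifted) H window is alive. [folklore] -/
theorem kappa_arith_lev_equi_slot1 (x ω εH : ℚ) (εG : Fin 3 → Fin 3 → ℚ) {d n₁ k ℓ₁ ℓ₂ : ℕ} (hd : 2 ≤ d) (hl : n₁ % 2 = d % 2)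
    (hk : 2 * k + d = n₁ + n₁ + n₁ + 2) (hfg : 2 * d ≤ n₁ + 1) (hℓ₁ : ℓ₁ ≤ 2) (hℓ₂ : ℓ₂ ≤ n₁ + ℓ₁) (hcorner : d % 2 = 0 → ℓ₁ = 1 → d + 1 ≤ ℓ₂)
    (i : Fin 3) (hi : i = 1) :
    (if n₁ = n₁ ∧ n₁ = n₁ then εH * (if max 1 d ≤ min (n₁ - ℓ₁ - (n₁ - ℓ₁) / 2) (min ((2 * n₁ - ℓ₂) / 2 - (n₁ - ℓ₁) / 2) ((2 * n₁ - d + 1 - ℓ₁) / 2 - (n₁ - ℓ₁) / 2)) then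
          x ^ (2 * ((n₁ - ℓ₁) / 2) + min (n₁ - ℓ₁ - (n₁ - ℓ₁) / 2) (min ((2 * n₁ - ℓ₂) / 2 - (n₁ - ℓ₁) / 2) ((2 * n₁ - d + 1 - ℓ₁) / 2 - (n₁ - ℓ₁) / 2)) + 1) - x ^ (2 * ((n₁ - ℓ₁) / 2) + max 1 d) else 0) else 0) +
        ((if i = 0 then (if min (min n₁ n₁) (min (n₁ - ℓ₁) (2 * n₁ - ℓ₂)) / 2 + d ≤ (n₁ - ℓ₁) / 2 then
            ω * (x ^ ((n₁ - ℓ₁) / 2 + min (min n₁ n₁) (min (n₁ - ℓ₁) (2 * n₁ - ℓ₂)) / 2 + 1) - x ^ (2 * (min (min n₁ n₁) (min (n₁ - ℓ₁) (2 * n₁ - ℓ₂)) / 2) + d)) else 0) else 0) +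
          (if n₁ = n₁ ∧ n₁ < n₁ ∧ (n₁ - n₁) % 2 = 0 then εG 0 i *
            (if max 1 (if i = 0 then d - (n₁ - n₁) / 2 else d) ≤ min (n₁ - ℓ₁ - (n₁ - ℓ₁) / 2) (min ((2 * n₁ - ℓ₂) / 2 - (n₁ - ℓ₁) / 2) ((2 * n₁ - d + 1 - ℓ₁) / 2 - (n₁ - ℓ₁) / 2)) then
              x ^ (2 * ((n₁ - ℓ₁) / 2) + (n₁ - n₁) / 2 + min (n₁ - ℓ₁ - (n₁ - ℓ₁) / 2) (min ((2 * n₁ - ℓ₂) / 2 - (n₁ - ℓ₁) / 2) ((2 * n₁ - d + 1 - ℓ₁) / 2 - (n₁ - ℓ₁) / 2)) + 1) -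
                x ^ (2 * ((n₁ - ℓ₁) / 2) + (n₁ - n₁) / 2 + max 1 (if i = 0 then d - (n₁ - n₁) / 2 else d)) else 0) else 0)) +
        ((if i = 1 then (if min (min n₁ n₁) (min (n₁ - ℓ₁) (2 * n₁ - ℓ₂)) / 2 + d ≤ (n₁ - ℓ₁) / 2 then
            ω * (x ^ ((n₁ - ℓ₁) / 2 + min (min n₁ n₁) (min (n₁ - ℓ₁) (2 * n₁ - ℓ₂)) / 2 + 1) - x ^ (2 * (min (min n₁ n₁) (min (n₁ - ℓ₁) (2 * n₁ - ℓ₂)) / 2) + d)) else 0) else 0) +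
          (if n₁ = n₁ ∧ n₁ < n₁ ∧ (n₁ - n₁) % 2 = 0 then εG 1 i *
            (if max 1 (if i = 1 then d - (n₁ - n₁) / 2 else d) ≤ min (n₁ - ℓ₁ - (n₁ - ℓ₁) / 2) (min ((2 * n₁ - ℓ₂) / 2 - (n₁ - ℓ₁) / 2) ((2 * n₁ - d + 1 - ℓ₁) / 2 - (n₁ - ℓ₁) / 2)) then
              x ^ (2 * ((n₁ - ℓ₁) / 2) + (n₁ - n₁) / 2 + min (n₁ - ℓ₁ - (n₁ - ℓ₁) / 2) (min ((2 * n₁ - ℓ₂) / 2 - (n₁ - ℓ₁) / 2) ((2 * n₁ - d + 1 - ℓ₁) / 2 - (n₁ - ℓ₁) / 2)) + 1) -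
                x ^ (2 * ((n₁ - ℓ₁) / 2) + (n₁ - n₁) / 2 + max 1 (if i = 1 then d - (n₁ - n₁) / 2 else d)) else 0) else 0)) +
        ((if i = 2 then (if min (min n₁ n₁) (min (n₁ - ℓ₁) (2 * n₁ - ℓ₂)) / 2 + d ≤ (n₁ - ℓ₁) / 2 then
            ω * (x ^ ((n₁ - ℓ₁) / 2 + min (min n₁ n₁) (min (n₁ - ℓ₁) (2 * n₁ - ℓ₂)) / 2 + 1) - x ^ (2 * (min (min n₁ n₁) (min (n₁ - ℓ₁) (2 * n₁ - ℓ₂)) / 2) + d)) else 0) else 0) +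
          (if n₁ = n₁ ∧ n₁ < n₁ ∧ (n₁ - n₁) % 2 = 0 then εG 2 i *
            (if max 1 (if i = 2 then d - (n₁ - n₁) / 2 else d) ≤ min (n₁ - ℓ₁ - (n₁ - ℓ₁) / 2) (min ((2 * n₁ - ℓ₂) / 2 - (n₁ - ℓ₁) / 2) ((2 * n₁ - d + 1 - ℓ₁) / 2 - (n₁ - ℓ₁) / 2)) then
              x ^ (2 * ((n₁ - ℓ₁) / 2) + (n₁ - n₁) / 2 + min (n₁ - ℓ₁ - (n₁ - ℓ₁) / 2) (min ((2 * n₁ - ℓ₂) / 2 - (n₁ - ℓ₁) / 2) ((2 * n₁ - d + 1 - ℓ₁) / 2 - (n₁ - ℓ₁) / 2)) + 1) -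
                x ^ (2 * ((n₁ - ℓ₁) / 2) + (n₁ - n₁) / 2 + max 1 (if i = 2 then d - (n₁ - n₁) / 2 else d)) else 0) else 0))
      = (if n₁ = n₁ ∧ n₁ = n₁ then εH else if n₁ = n₁ then εG 0 i else if n₁ = n₁ then εG 1 i else εG 2 i) *
        (x ^ (k - max ℓ₁ ((ℓ₂ + 1) / 2 - d / 2 + (ℓ₁ + 1 - d % 2) / 2)) -
          x ^ (k - max (max ℓ₁ ((ℓ₂ + 1) / 2 - d / 2 + (ℓ₁ + 1 - d % 2) / 2))
            ((((![n₁, n₁, n₁] : Fin 3 → ℕ) i + 2 * (d % 2) + 2 - 3 * d) / 2) + 2 * ((ℓ₁ + 1 - d % 2) / 2)))) := by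
  subst hi
  obtain ⟨δ, e, hδ, rfl⟩ : ∃ δ e, δ ≤ 1 ∧ d = 2 * e + δ := ⟨d % 2, d / 2, by omega, by omega⟩
  obtain ⟨a, rfl⟩ : ∃ a, n₁ = 2 * a + δ := ⟨n₁ / 2, by omega⟩
  obtain ⟨t₁, ht₁⟩ : ∃ t₁, 2 * a + δ = t₁ + ℓ₁ := ⟨2 * a + δ - ℓ₁, by omega⟩
  obtain ⟨t₂, ht₂⟩ : ∃ t₂, 2 * (2 * a + δ) = t₂ + ℓ₂ := ⟨2 * (2 * a + δ) - ℓ₂, by omega⟩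
  obtain ⟨t₃, ht₃⟩ : ∃ t₃, 2 * (2 * a + δ) + 1 = t₃ + (2 * e + δ) + ℓ₁ := ⟨2 * (2 * a + δ) + 1 - (2 * e + δ) - ℓ₁, by omega⟩
  obtain ⟨M, μ, hμ, hM⟩ : ∃ M μ, μ ≤ 1 ∧ t₁ = 2 * M + μ := ⟨t₁ / 2, t₁ % 2, by omega, by omega⟩
  obtain ⟨W, ν, hν, hW⟩ : ∃ W ν, ν ≤ 1 ∧ t₂ = 2 * W + ν := ⟨t₂ / 2, t₂ % 2, by omega, by omega⟩
  obtain ⟨V, κ, hκ, hV⟩ : ∃ V κ, κ ≤ 1 ∧ t₃ = 2 * V + κ := ⟨t₃ / 2, t₃ % 2, by omega, by omega⟩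
  obtain ⟨Gh, γ, hγ, hGh⟩ : ∃ Gh γ, γ ≤ 1 ∧ ℓ₂ + 1 = 2 * Gh + γ := ⟨(ℓ₂ + 1) / 2, (ℓ₂ + 1) % 2, by omega, by omega⟩
  obtain ⟨Yh, ψ, hψ, hYh⟩ : ∃ Yh ψ, ψ ≤ 1 ∧ ℓ₁ + 1 = 2 * Yh + ψ + δ := ⟨(ℓ₁ + 1 - δ) / 2, (ℓ₁ + 1 - δ) % 2, by omega, by omega⟩
  obtain ⟨r9, r10, r11⟩ : (2 * a + δ - ℓ₁ = t₁) ∧ (2 * (2 * a + δ) - ℓ₂ = t₂) ∧ (2 * (2 * a + δ) - (2 * e + δ) + 1 - ℓ₁ = t₃) :=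
    ⟨by clear * - hδ hd hℓ₁ hℓ₂ hfg ht₁ ht₂ ht₃; omega, by clear * - hδ hd hℓ₁ hℓ₂ hfg ht₁ ht₂ ht₃; omega, by clear * - hδ hd hℓ₁ hℓ₂ hfg ht₁ ht₂ ht₃; omega⟩
  obtain ⟨r13, r15, r17⟩ : (t₁ / 2 = M) ∧ (t₁ - M = M + μ) ∧ (t₂ / 2 = W) := ⟨by clear * - hμ hM; omega, by clear * - hμ hM; omega, by clear * - hν hW; omega⟩
  obtain ⟨r18, r19, r20⟩ : (t₃ / 2 = V) ∧ ((ℓ₂ + 1) / 2 = Gh) ∧ ((ℓ₁ + 1 - δ) / 2 = Yh) := ⟨by clear * - hκ hV; omega, by clear * - hγ hGh; omega, by clear * - hψ hYh hδ; omega⟩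
  obtain ⟨r1, r2, r7⟩ : ((2 * e + δ) % 2 = δ) ∧ ((2 * e + δ) / 2 = e) ∧ ((2 * a + δ + 2 * δ + 2 - 3 * (2 * e + δ)) / 2 = a + 1 - 3 * e) :=
    ⟨by clear * - hδ; omega, by clear * - hδ; omega, by clear * - hδ; omega⟩
  have rN : min (min (2 * a + δ) (2 * a + δ)) (min t₁ t₂) = t₁ := by clear * - hδ hd hℓ₁ hℓ₂ hfg ht₁ ht₂ ht₃; omega
  (try simp only [lt_self_iff_false]); (try simp only [Nat.sub_self, Nat.zero_mod]); (try simp only [false_and]); (try simp only [and_false]); (try simp only [and_self])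
  (try simp only [↓reduceIte]); (try simp only [Fin.isValue, Fin.reduceEq]); (try simp only [↓reduceIte]); (try simp only [zero_add]); (try simp only [add_zero])
  (try simp only [r1]); (try simp only [r2]); (try simp only [Matrix.cons_val_one])
  (try simp only [Matrix.cons_val_zero]); (try simp only [r7]); (try simp only [r9]); (try simp only [r10]); (try simp only [r11])
  (try simp only [r19]); (try simp only [r20]); (try simp only [rN]); (try simp only [r13]); (try simp only [r15]); (try simp only [r17])
  (try simp only [r18])
  clear r1 r2 r7 r9 r10 r11 r13 r15 r17 r18 r19 r20 rN hl
  have hk' : k + e = 3 * a + 0 + δ + 1 := by clear * - hk; omega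
  clear hk
  obtain ⟨cW, rfl⟩ : ∃ cW, W = M + cW := ⟨W - M, by clear * - hδ hℓ₁ hℓ₂ ht₁ ht₂ hμ hM hν hW; omega⟩
  obtain ⟨cV, rfl⟩ : ∃ cV, V = M + cV := ⟨V - M, by clear * - hδ hd hℓ₁ hfg ht₁ ht₃ hμ hM hκ hV; omega⟩
  simp only [Nat.add_sub_cancel_left]
  obtain ⟨hM', hcW, hcV⟩ : (2 * M + μ + ℓ₁ = 2 * a + δ) ∧ (cW + Gh = M + μ + ℓ₁) ∧ (cV + e = a + μ) :=
    ⟨by clear * - hM ht₁; omega, by clear * - hM ht₁ hW ht₂ hGh hν hγ hℓ₂; omega, by clear * - hM ht₁ hV ht₃ hκ hμ hδ hfg; omega⟩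
  have hYh' : 2 * Yh + δ = ℓ₁ + μ := by clear * - hM ht₁ hYh hψ hμ hδ hℓ₁; omega
  clear ht₁ ht₂ ht₃ hM hW hV hYh hν hκ hψ
  generalize hC : min (M + μ) (min cW cV) = C
  have hC3 := min3_linear (M + μ) cW cV
  rw [hC] at hC3
  obtain ⟨x₂, hx₂, hx₂eq⟩ : ∃ x₂ : ℕ, ((e ≤ Gh ∧ Gh = e + x₂) ∨ (Gh < e ∧ x₂ = 0)) ∧ Gh - e = x₂ := by
    by_cases hGe : e ≤ Gh
    · exact ⟨Gh - e, Or.inl ⟨hGe, by omega⟩, rfl⟩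
    · exact ⟨0, Or.inr ⟨by omega, rfl⟩, by omega⟩
  rw [hx₂eq]
  generalize hX : max ℓ₁ (x₂ + Yh) = X
  have hX2 := max_linear ℓ₁ (x₂ + Yh)
  rw [hX] at hX2
  clear hC hX hx₂eq
  obtain ⟨Bq, hB, hBeq⟩ : ∃ Bq : ℕ, ((3 * e ≤ a + 1 ∧ Bq + 3 * e = a + 1) ∨ (a + 1 < 3 * e ∧ Bq = 0)) ∧ a + 1 - 3 * e = Bq := by
    by_cases h3 : 3 * e ≤ a + 1
    · exact ⟨a + 1 - 3 * e, Or.inl ⟨h3, by omega⟩, rfl⟩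
    · exact ⟨0, Or.inr ⟨by omega, rfl⟩, by omega⟩
  rw [hBeq]
  clear hBeq
  generalize hP : max X (Bq + 2 * Yh) = P
  have hP2 := max_linear X (Bq + 2 * Yh)
  rw [hP] at hP2
  clear hP
  have htube : ¬ (M + (2 * e + δ) ≤ M) := by clear * - hd; omega
  rw [if_neg htube, max_eq_right (show 1 ≤ 2 * e + δ by clear * - hd; omega)]
  (try simp only [add_zero])
  by_cases hwin : 2 * e + δ ≤ C
  · rw [if_pos hwin]
    exact leaf_T (by have h := lev_arith_top _ _ _ _ _ _ _ _ _ _ _ _ hδ hd hℓ₁ hμ hM' hcW hcV hYh' hk' _ hC3 _ hx₂ _ hX2; clear * - h; omega) (by have h := lev_arith_cross_bot _ _ _ _ _ _ _ _ _ _ _ _ hδ hd hℓ₁ hfg hμ hM' hcW hcV hYh' hk' _ hC3 _ hx₂ _ hX2 _ hB _ hP2 hwin; clear * - h; omega)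
  · rw [if_neg hwin, mul_zero]
    exact leaf_Z (by have h := lev_arith_cross_empty _ _ _ _ _ _ _ _ _ _ _ _ _ _ hδ hd hℓ₁ hcorner hfg hμ hM' hcW hcV hγ hGh hYh' hk' _ hC3 _ hx₂ _ hX2 _ hB _ hP2 hwin; clear * - h; omega)

/-- The lev tiling, equilateral key, slot `2`: only the (shifted) H window is alive. [folklore] -/
theorem kappa_arith_lev_equi_slot2 (x ω εH : ℚ) (εG : Fin 3 → Fin 3 → ℚ) {d n₁ k ℓ₁ ℓ₂ : ℕ} (hd : 2 ≤ d) (hl : n₁ % 2 = d % 2)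
    (hk : 2 * k + d = n₁ + n₁ + n₁ + 2) (hfg : 2 * d ≤ n₁ + 1) (hℓ₁ : ℓ₁ ≤ 2) (hℓ₂ : ℓ₂ ≤ n₁ + ℓ₁) (hcorner : d % 2 = 0 → ℓ₁ = 1 → d + 1 ≤ ℓ₂)
    (i : Fin 3) (hi : i = 2) :
    (if n₁ = n₁ ∧ n₁ = n₁ then εH * (if max 1 d ≤ min (n₁ - ℓ₁ - (n₁ - ℓ₁) / 2) (min ((2 * n₁ - ℓ₂) / 2 - (n₁ - ℓ₁) / 2) ((2 * n₁ - d + 1 - ℓ₁) / 2 - (n₁ - ℓ₁) / 2)) then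
          x ^ (2 * ((n₁ - ℓ₁) / 2) + min (n₁ - ℓ₁ - (n₁ - ℓ₁) / 2) (min ((2 * n₁ - ℓ₂) / 2 - (n₁ - ℓ₁) / 2) ((2 * n₁ - d + 1 - ℓ₁) / 2 - (n₁ - ℓ₁) / 2)) + 1) - x ^ (2 * ((n₁ - ℓ₁) / 2) + max 1 d) else 0) else 0) +
        ((if i = 0 then (if min (min n₁ n₁) (min (n₁ - ℓ₁) (2 * n₁ - ℓ₂)) / 2 + d ≤ (n₁ - ℓ₁) / 2 then
            ω * (x ^ ((n₁ - ℓ₁) / 2 + min (min n₁ n₁) (min (n₁ - ℓ₁) (2 * n₁ - ℓ₂)) / 2 + 1) - x ^ (2 * (min (min n₁ n₁) (min (n₁ - ℓ₁) (2 * n₁ - ℓ₂)) / 2) + d)) else 0) else 0) +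
          (if n₁ = n₁ ∧ n₁ < n₁ ∧ (n₁ - n₁) % 2 = 0 then εG 0 i *
            (if max 1 (if i = 0 then d - (n₁ - n₁) / 2 else d) ≤ min (n₁ - ℓ₁ - (n₁ - ℓ₁) / 2) (min ((2 * n₁ - ℓ₂) / 2 - (n₁ - ℓ₁) / 2) ((2 * n₁ - d + 1 - ℓ₁) / 2 - (n₁ - ℓ₁) / 2)) then
              x ^ (2 * ((n₁ - ℓ₁) / 2) + (n₁ - n₁) / 2 + min (n₁ - ℓ₁ - (n₁ - ℓ₁) / 2) (min ((2 * n₁ - ℓ₂) / 2 - (n₁ - ℓ₁) / 2) ((2 * n₁ - d + 1 - ℓ₁) / 2 - (n₁ - ℓ₁) / 2)) + 1) -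
                x ^ (2 * ((n₁ - ℓ₁) / 2) + (n₁ - n₁) / 2 + max 1 (if i = 0 then d - (n₁ - n₁) / 2 else d)) else 0) else 0)) +
        ((if i = 1 then (if min (min n₁ n₁) (min (n₁ - ℓ₁) (2 * n₁ - ℓ₂)) / 2 + d ≤ (n₁ - ℓ₁) / 2 then
            ω * (x ^ ((n₁ - ℓ₁) / 2 + min (min n₁ n₁) (min (n₁ - ℓ₁) (2 * n₁ - ℓ₂)) / 2 + 1) - x ^ (2 * (min (min n₁ n₁) (min (n₁ - ℓ₁) (2 * n₁ - ℓ₂)) / 2) + d)) else 0) else 0) +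
          (if n₁ = n₁ ∧ n₁ < n₁ ∧ (n₁ - n₁) % 2 = 0 then εG 1 i *
            (if max 1 (if i = 1 then d - (n₁ - n₁) / 2 else d) ≤ min (n₁ - ℓ₁ - (n₁ - ℓ₁) / 2) (min ((2 * n₁ - ℓ₂) / 2 - (n₁ - ℓ₁) / 2) ((2 * n₁ - d + 1 - ℓ₁) / 2 - (n₁ - ℓ₁) / 2)) then
              x ^ (2 * ((n₁ - ℓ₁) / 2) + (n₁ - n₁) / 2 + min (n₁ - ℓ₁ - (n₁ - ℓ₁) / 2) (min ((2 * n₁ - ℓ₂) / 2 - (n₁ - ℓ₁) / 2) ((2 * n₁ - d + 1 - ℓ₁) / 2 - (n₁ - ℓ₁) / 2)) + 1) -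
                x ^ (2 * ((n₁ - ℓ₁) / 2) + (n₁ - n₁) / 2 + max 1 (if i = 1 then d - (n₁ - n₁) / 2 else d)) else 0) else 0)) +
        ((if i = 2 then (if min (min n₁ n₁) (min (n₁ - ℓ₁) (2 * n₁ - ℓ₂)) / 2 + d ≤ (n₁ - ℓ₁) / 2 then
            ω * (x ^ ((n₁ - ℓ₁) / 2 + min (min n₁ n₁) (min (n₁ - ℓ₁) (2 * n₁ - ℓ₂)) / 2 + 1) - x ^ (2 * (min (min n₁ n₁) (min (n₁ - ℓ₁) (2 * n₁ - ℓ₂)) / 2) + d)) else 0) else 0) +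
          (if n₁ = n₁ ∧ n₁ < n₁ ∧ (n₁ - n₁) % 2 = 0 then εG 2 i *
            (if max 1 (if i = 2 then d - (n₁ - n₁) / 2 else d) ≤ min (n₁ - ℓ₁ - (n₁ - ℓ₁) / 2) (min ((2 * n₁ - ℓ₂) / 2 - (n₁ - ℓ₁) / 2) ((2 * n₁ - d + 1 - ℓ₁) / 2 - (n₁ - ℓ₁) / 2)) then
              x ^ (2 * ((n₁ - ℓ₁) / 2) + (n₁ - n₁) / 2 + min (n₁ - ℓ₁ - (n₁ - ℓ₁) / 2) (min ((2 * n₁ - ℓ₂) / 2 - (n₁ - ℓ₁) / 2) ((2 * n₁ - d + 1 - ℓ₁) / 2 - (n₁ - ℓ₁) / 2)) + 1) -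
                x ^ (2 * ((n₁ - ℓ₁) / 2) + (n₁ - n₁) / 2 + max 1 (if i = 2 then d - (n₁ - n₁) / 2 else d)) else 0) else 0))
      = (if n₁ = n₁ ∧ n₁ = n₁ then εH else if n₁ = n₁ then εG 0 i else if n₁ = n₁ then εG 1 i else εG 2 i) *
        (x ^ (k - max ℓ₁ ((ℓ₂ + 1) / 2 - d / 2 + (ℓ₁ + 1 - d % 2) / 2)) -
          x ^ (k - max (max ℓ₁ ((ℓ₂ + 1) / 2 - d / 2 + (ℓ₁ + 1 - d % 2) / 2))
            ((((![n₁, n₁, n₁] : Fin 3 → ℕ) i + 2 * (d % 2) + 2 - 3 * d) / 2) + 2 * ((ℓ₁ + 1 - d % 2) / 2)))) := by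
  subst hi
  obtain ⟨δ, e, hδ, rfl⟩ : ∃ δ e, δ ≤ 1 ∧ d = 2 * e + δ := ⟨d % 2, d / 2, by omega, by omega⟩
  obtain ⟨a, rfl⟩ : ∃ a, n₁ = 2 * a + δ := ⟨n₁ / 2, by omega⟩
  obtain ⟨t₁, ht₁⟩ : ∃ t₁, 2 * a + δ = t₁ + ℓ₁ := ⟨2 * a + δ - ℓ₁, by omega⟩
  obtain ⟨t₂, ht₂⟩ : ∃ t₂, 2 * (2 * a + δ) = t₂ + ℓ₂ := ⟨2 * (2 * a + δ) - ℓ₂, by omega⟩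
  obtain ⟨t₃, ht₃⟩ : ∃ t₃, 2 * (2 * a + δ) + 1 = t₃ + (2 * e + δ) + ℓ₁ := ⟨2 * (2 * a + δ) + 1 - (2 * e + δ) - ℓ₁, by omega⟩
  obtain ⟨M, μ, hμ, hM⟩ : ∃ M μ, μ ≤ 1 ∧ t₁ = 2 * M + μ := ⟨t₁ / 2, t₁ % 2, by omega, by omega⟩
  obtain ⟨W, ν, hν, hW⟩ : ∃ W ν, ν ≤ 1 ∧ t₂ = 2 * W + ν := ⟨t₂ / 2, t₂ % 2, by omega, by omega⟩
  obtain ⟨V, κ, hκ, hV⟩ : ∃ V κ, κ ≤ 1 ∧ t₃ = 2 * V + κ := ⟨t₃ / 2, t₃ % 2, by omega, by omega⟩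
  obtain ⟨Gh, γ, hγ, hGh⟩ : ∃ Gh γ, γ ≤ 1 ∧ ℓ₂ + 1 = 2 * Gh + γ := ⟨(ℓ₂ + 1) / 2, (ℓ₂ + 1) % 2, by omega, by omega⟩
  obtain ⟨Yh, ψ, hψ, hYh⟩ : ∃ Yh ψ, ψ ≤ 1 ∧ ℓ₁ + 1 = 2 * Yh + ψ + δ := ⟨(ℓ₁ + 1 - δ) / 2, (ℓ₁ + 1 - δ) % 2, by omega, by omega⟩
  obtain ⟨r9, r10, r11⟩ : (2 * a + δ - ℓ₁ = t₁) ∧ (2 * (2 * a + δ) - ℓ₂ = t₂) ∧ (2 * (2 * a + δ) - (2 * e + δ) + 1 - ℓ₁ = t₃) :=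
    ⟨by clear * - hδ hd hℓ₁ hℓ₂ hfg ht₁ ht₂ ht₃; omega, by clear * - hδ hd hℓ₁ hℓ₂ hfg ht₁ ht₂ ht₃; omega, by clear * - hδ hd hℓ₁ hℓ₂ hfg ht₁ ht₂ ht₃; omega⟩
  obtain ⟨r13, r15, r17⟩ : (t₁ / 2 = M) ∧ (t₁ - M = M + μ) ∧ (t₂ / 2 = W) := ⟨by clear * - hμ hM; omega, by clear * - hμ hM; omega, by clear * - hν hW; omega⟩
  obtain ⟨r18, r19, r20⟩ : (t₃ / 2 = V) ∧ ((ℓ₂ + 1) / 2 = Gh) ∧ ((ℓ₁ + 1 - δ) / 2 = Yh) := ⟨by clear * - hκ hV; omega, by clear * - hγ hGh; omega, by clear * - hψ hYh hδ; omega⟩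
  obtain ⟨r1, r2, r7⟩ : ((2 * e + δ) % 2 = δ) ∧ ((2 * e + δ) / 2 = e) ∧ ((2 * a + δ + 2 * δ + 2 - 3 * (2 * e + δ)) / 2 = a + 1 - 3 * e) :=
    ⟨by clear * - hδ; omega, by clear * - hδ; omega, by clear * - hδ; omega⟩
  have rN : min (min (2 * a + δ) (2 * a + δ)) (min t₁ t₂) = t₁ := by clear * - hδ hd hℓ₁ hℓ₂ hfg ht₁ ht₂ ht₃; omega
  (try simp only [lt_self_iff_false]); (try simp only [Nat.sub_self, Nat.zero_mod]); (try simp only [false_and]); (try simp only [and_false]); (try simp only [and_self])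
  (try simp only [↓reduceIte]); (try simp only [Fin.isValue, Fin.reduceEq]); (try simp only [↓reduceIte]); (try simp only [zero_add]); (try simp only [add_zero])
  (try simp only [r1]); (try simp only [r2]); (try simp only [Matrix.cons_val_two]); (try simp only [Matrix.tail_cons]); (try simp only [Matrix.head_cons])
  (try simp only [r7]); (try simp only [r9]); (try simp only [r10]); (try simp only [r11])
  (try simp only [r19]); (try simp only [r20]); (try simp only [rN]); (try simp only [r13]); (try simp only [r15]); (try simp only [r17])
  (try simp only [r18])
  clear r1 r2 r7 r9 r10 r11 r13 r15 r17 r18 r19 r20 rN hl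
  have hk' : k + e = 3 * a + 0 + δ + 1 := by clear * - hk; omega
  clear hk
  obtain ⟨cW, rfl⟩ : ∃ cW, W = M + cW := ⟨W - M, by clear * - hδ hℓ₁ hℓ₂ ht₁ ht₂ hμ hM hν hW; omega⟩
  obtain ⟨cV, rfl⟩ : ∃ cV, V = M + cV := ⟨V - M, by clear * - hδ hd hℓ₁ hfg ht₁ ht₃ hμ hM hκ hV; omega⟩
  simp only [Nat.add_sub_cancel_left]
  obtain ⟨hM', hcW, hcV⟩ : (2 * M + μ + ℓ₁ = 2 * a + δ) ∧ (cW + Gh = M + μ + ℓ₁) ∧ (cV + e = a + μ) :=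
    ⟨by clear * - hM ht₁; omega, by clear * - hM ht₁ hW ht₂ hGh hν hγ hℓ₂; omega, by clear * - hM ht₁ hV ht₃ hκ hμ hδ hfg; omega⟩
  have hYh' : 2 * Yh + δ = ℓ₁ + μ := by clear * - hM ht₁ hYh hψ hμ hδ hℓ₁; omega
  clear ht₁ ht₂ ht₃ hM hW hV hYh hν hκ hψ
  generalize hC : min (M + μ) (min cW cV) = C
  have hC3 := min3_linear (M + μ) cW cV
  rw [hC] at hC3
  obtain ⟨x₂, hx₂, hx₂eq⟩ : ∃ x₂ : ℕ, ((e ≤ Gh ∧ Gh = e + x₂) ∨ (Gh < e ∧ x₂ = 0)) ∧ Gh - e = x₂ := by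
    by_cases hGe : e ≤ Gh
    · exact ⟨Gh - e, Or.inl ⟨hGe, by omega⟩, rfl⟩
    · exact ⟨0, Or.inr ⟨by omega, rfl⟩, by omega⟩
  rw [hx₂eq]
  generalize hX : max ℓ₁ (x₂ + Yh) = X
  have hX2 := max_linear ℓ₁ (x₂ + Yh)
  rw [hX] at hX2
  clear hC hX hx₂eq
  obtain ⟨Bq, hB, hBeq⟩ : ∃ Bq : ℕ, ((3 * e ≤ a + 1 ∧ Bq + 3 * e = a + 1) ∨ (a + 1 < 3 * e ∧ Bq = 0)) ∧ a + 1 - 3 * e = Bq := by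
    by_cases h3 : 3 * e ≤ a + 1
    · exact ⟨a + 1 - 3 * e, Or.inl ⟨h3, by omega⟩, rfl⟩
    · exact ⟨0, Or.inr ⟨by omega, rfl⟩, by omega⟩
  rw [hBeq]
  clear hBeq
  generalize hP : max X (Bq + 2 * Yh) = P
  have hP2 := max_linear X (Bq + 2 * Yh)
  rw [hP] at hP2
  clear hP
  have htube : ¬ (M + (2 * e + δ) ≤ M) := by clear * - hd; omega
  rw [if_neg htube, max_eq_right (show 1 ≤ 2 * e + δ by clear * - hd; omega)]
  (try simp only [add_zero])
  by_cases hwin : 2 * e + δ ≤ C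
  · rw [if_pos hwin]
    exact leaf_T (by have h := lev_arith_top _ _ _ _ _ _ _ _ _ _ _ _ hδ hd hℓ₁ hμ hM' hcW hcV hYh' hk' _ hC3 _ hx₂ _ hX2; clear * - h; omega) (by have h := lev_arith_cross_bot _ _ _ _ _ _ _ _ _ _ _ _ hδ hd hℓ₁ hfg hμ hM' hcW hcV hYh' hk' _ hC3 _ hx₂ _ hX2 _ hB _ hP2 hwin; clear * - h; omega)
  · rw [if_neg hwin, mul_zero]
    exact leaf_Z (by have h := lev_arith_cross_empty _ _ _ _ _ _ _ _ _ _ _ _ _ _ hδ hd hℓ₁ hcorner hfg hμ hM' hcW hcV hγ hGh hYh' hk' _ hC3 _ hx₂ _ hX2 _ hB _ hP2 hwin; clear * - h; omega)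

end Summit.HodgeConjecture.HodgeConjecture.Cruxes.H413.F0P3cDyRamLevBoxSumTilingEqui
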